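import Mathlib
import HarnessLib
import Summits.Parity.BatemanHorn.Theorems.IsogenyRedeiSplitBlockJacobiWeylDefs
import Summits.Parity.BatemanHorn.Theorems.IsogenyRedeiSplitBlockJacobiRootWeylSumCRT
import Literature.NumberTheory.Sieve.IwaniecAlmostPrimesVW
import Literature.NumberTheory.Sieve.DivisorBound

/-!
# Support lemmas for `stub_mbb_of_boxInputs` (line `Sketch`, crux `SplitBlockJacobiCorner`,
# stmt-Parity-15002): support and trivial bounds of the root Weyl sum

Def-free over the landed `rootWeylSum h q = S(h,q) = Σ_{ν mod q, ν² ≡ -1} e(hν/q)`: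

* §A support: `S(h, N) = 0` as soon as `4 ∣ N` or an odd `d ∣ N` has `d ≢ 1 (mod 4)`; hence the
  congruence filters `≡ 1 (mod 4)` move freely between a product `ab ∣ N` and its factors on the
  support of `S(h, N)` (`mul_mod_four_eq_one_iff_of_rootWeylSum_ne_zero`), and quadratic reciprocity
  has sign `+1` there (`kernel_swap`);
* §B trivial bounds: `‖S(h,N)‖ ≤ ρ(N) ≤ τ(N)`, `τ(mn) ≤ τ(m)τ(n)`, so the kernel
  `K_h(n,q) = (n|q)·S(h,nq)` has `‖K_h(n,q)‖ ≤ τ(n)τ(q)`, and the divisor bound `τ(n) ≤ C_ε n^ε`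
  (tree: `Literature.NumberTheory.Sieve.exists_card_divisors_le_mul_rpow'`).
-/

noncomputable section

open Finset

namespace Summit.Parity.BatemanHorn.Cruxes.SplitBlockJacobiCorner.Sketch.MbbOfBoxInputs

open Summit.Parity.BatemanHorn.Cruxes.SplitBlockJacobi.CofactorRootDiscrepancy
open Literature.NumberTheory.Sieve.Iwaniec1978 (rho rho_le_card_divisors)

/-! ### §A Support of the root Weyl sum -/

/-- If `q ∣ ν² + 1` then `-1` is a square modulo `q`. [folklore] -/
theorem isSquare_neg_one_of_dvd_sq_add_one {q ν : ℕ} (hν : q ∣ ν ^ 2 + 1) :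
    IsSquare (-1 : ZMod q) := by
  refine ⟨(ν : ZMod q), ?_⟩
  have h0 : ((ν ^ 2 + 1 : ℕ) : ZMod q) = 0 := (ZMod.natCast_eq_zero_iff _ _).mpr hν
  push_cast at h0
  linear_combination -h0

/-- A number all of whose prime factors are `≡ 1 (mod 4)` is itself `≡ 1 (mod 4)`. [folklore] -/
theorem mod_four_eq_one_of_forall_prime {q : ℕ} (hq0 : q ≠ 0)
    (h : ∀ p : ℕ, p.Prime → p ∣ q → p % 4 = 1) : q % 4 = 1 := by
  induction q using Nat.recOnMul with
  | zero => exact absurd rfl hq0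
  | one => rfl
  | prime p hp => exact h p hp dvd_rfl
  | mul a b iha ihb =>
    have ha0 : a ≠ 0 := by rintro rfl; simp at hq0
    have hb0 : b ≠ 0 := by rintro rfl; simp at hq0
    have ha4 : a % 4 = 1 := iha ha0 fun r hr hra => h r hr (dvd_mul_of_dvd_left hra b)
    have hb4 : b % 4 = 1 := ihb hb0 fun r hr hrb => h r hr (dvd_mul_of_dvd_right hrb a)
    rw [Nat.mul_mod, ha4, hb4]

/-- An ODD modulus that carries a root of `ν² ≡ -1` is `≡ 1 (mod 4)`. [folklore] -/
theorem mod_four_eq_one_of_odd_of_dvd_sq_add_one {q ν : ℕ} (hq : Odd q) (hν : q ∣ ν ^ 2 + 1) :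
    q % 4 = 1 := by
  have hq0 : q ≠ 0 := hq.pos.ne'
  have hs : IsSquare (-1 : ZMod q) := isSquare_neg_one_of_dvd_sq_add_one hν
  refine mod_four_eq_one_of_forall_prime hq0 fun p hp hpq => ?_
  have h3 : p % 4 ≠ 3 :=
    Nat.mod_four_ne_three_of_mem_primeFactors_of_isSquare_neg_one
      (Nat.mem_primeFactors.mpr ⟨hp, hpq, hq0⟩) hs
  have hp2 : p ≠ 2 := by
    rintro rfl
    exact (Nat.not_even_iff_odd.mpr hq) (even_iff_two_dvd.mpr hpq)
  have hodd : p % 2 = 1 := Nat.odd_iff.mp (hp.odd_of_ne_two hp2)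
  omega

/-- `S(h, N) = 0` as soon as an odd `d ≢ 1 (mod 4)` divides `N` (a root modulo `N` would reduce to
a root modulo `d`). [folklore] -/
theorem rootWeylSum_eq_zero_of_odd_dvd {d N : ℕ} (hd : Odd d) (hd1 : d % 4 ≠ 1) (hdN : d ∣ N)
    (h : ℤ) : rootWeylSum h N = 0 := by
  unfold rootWeylSum
  refine Finset.sum_eq_zero fun ν hν => ?_
  exfalso
  exact hd1 (mod_four_eq_one_of_odd_of_dvd_sq_add_one hd (hdN.trans (Finset.mem_filter.mp hν).2))

/-- `S(h, N) = 0` as soon as `4 ∣ N`: `ν² + 1 ≢ 0 (mod 4)`. [folklore] -/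
theorem rootWeylSum_eq_zero_of_four_dvd {N : ℕ} (h4 : 4 ∣ N) (h : ℤ) : rootWeylSum h N = 0 := by
  unfold rootWeylSum
  refine Finset.sum_eq_zero fun ν hν => ?_
  exfalso
  have hνq : 4 ∣ ν ^ 2 + 1 := h4.trans (Finset.mem_filter.mp hν).2
  have h0 : ((ν ^ 2 + 1 : ℕ) : ZMod 4) = 0 := (ZMod.natCast_eq_zero_iff _ _).mpr hνq
  push_cast at h0
  have key : ∀ x : ZMod 4, x ^ 2 + 1 ≠ 0 := by decide
  exact key _ h0

/-- On the support of `S(h, N)` every odd divisor of `N` is `≡ 1 (mod 4)`. [folklore] -/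
theorem mod_four_eq_one_of_odd_dvd_of_rootWeylSum_ne_zero {d N : ℕ} {h : ℤ}
    (hS : rootWeylSum h N ≠ 0) (hd : Odd d) (hdN : d ∣ N) : d % 4 = 1 := by
  by_contra h1
  exact hS (rootWeylSum_eq_zero_of_odd_dvd hd h1 hdN h)

/-- **The congruence filters move freely on the support**: if `S(h, N) ≠ 0` and `ab ∣ N`, then
`ab ≡ 1 (mod 4)` iff `a ≡ 1 (mod 4)` and `b ≡ 1 (mod 4)`. [folklore] -/
theorem mul_mod_four_eq_one_iff_of_rootWeylSum_ne_zero {a b N : ℕ} {h : ℤ}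
    (hS : rootWeylSum h N ≠ 0) (hab : a * b ∣ N) : (a * b) % 4 = 1 ↔ a % 4 = 1 ∧ b % 4 = 1 := by
  constructor
  · intro h1
    have hodd : Odd (a * b) := Nat.odd_iff.mpr (by omega)
    obtain ⟨ha, hb⟩ := Nat.odd_mul.mp hodd
    exact ⟨mod_four_eq_one_of_odd_dvd_of_rootWeylSum_ne_zero hS ha ((dvd_mul_right a b).trans hab),
      mod_four_eq_one_of_odd_dvd_of_rootWeylSum_ne_zero hS hb ((dvd_mul_left b a).trans hab)⟩
  · rintro ⟨ha, hb⟩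
    rw [Nat.mul_mod, ha, hb]

/-- Indicator form of the filter move, in the first variable of the kernel: for the summand
`F = c · S(h, a·b·q)`, `[ab ≡ 1] F = [a ≡ 1][b ≡ 1] F`. [folklore] -/
theorem ite_mul_mod_four_left (a b q : ℕ) (h : ℤ) (c : ℂ) :
    (if (a * b) % 4 = 1 then c * rootWeylSum h (a * b * q) else 0) =
      if a % 4 = 1 ∧ b % 4 = 1 then c * rootWeylSum h (a * b * q) else 0 := by
  by_cases hS : rootWeylSum h (a * b * q) = 0
  · simp [hS]
  · exact if_congr (mul_mod_four_eq_one_iff_of_rootWeylSum_ne_zero hS (dvd_mul_right _ _)) rfl rfl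

/-- Indicator form of the filter move, in the second variable: `[ab ≡ 1] c·S(h, n·(a·b)) =
[a ≡ 1][b ≡ 1] c·S(h, n·(a·b))`. [folklore] -/
theorem ite_mul_mod_four_right (n a b : ℕ) (h : ℤ) (c : ℂ) :
    (if (a * b) % 4 = 1 then c * rootWeylSum h (n * (a * b)) else 0) =
      if a % 4 = 1 ∧ b % 4 = 1 then c * rootWeylSum h (n * (a * b)) else 0 := by
  by_cases hS : rootWeylSum h (n * (a * b)) = 0
  · simp [hS]
  · exact if_congr (mul_mod_four_eq_one_iff_of_rootWeylSum_ne_zero hS (dvd_mul_left _ _)) rfl rfl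

/-- **Reciprocity on the support** (sign `+1`): for `n ≡ 1 (mod 4)` and `m ≡ 1 (mod 4)`,
`(n|m)·S(h, nm) = (m|n)·S(h, mn)`. [folklore] -/
theorem kernel_swap {n m : ℕ} (hn : n % 4 = 1) (hm : m % 4 = 1) (h : ℤ) :
    (jacobiSym (n : ℤ) m : ℂ) * rootWeylSum h (n * m) =
      (jacobiSym (m : ℤ) n : ℂ) * rootWeylSum h (m * n) := by
  rw [jacobiSym.quadratic_reciprocity_one_mod_four hn (Nat.odd_iff.mpr (by omega)), mul_comm n m]

/-- Adding a coprimality filter is free: `(n|q) = 0` unless `gcd(n, q) = 1`. [folklore] -/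
theorem jacobiSym_natCast_eq_zero_of_not_coprime {n q : ℕ} (hq : q ≠ 0) (hc : ¬ Nat.Coprime n q) :
    jacobiSym (n : ℤ) q = 0 := by
  haveI : NeZero q := ⟨hq⟩
  rw [jacobiSym.eq_zero_iff_not_coprime, Int.gcd_natCast_natCast]
  exact hc

/-! ### §B Trivial bounds -/

/-- `‖S(h, N)‖ ≤ τ(N)` (`‖S‖ ≤ ρ ≤ τ`, tree: `Weyl.norm_rootWeylSum_le_rho`, `rho_le_card_divisors`).
[folklore] -/
theorem norm_rootWeylSum_le_card_divisors (h : ℤ) (N : ℕ) :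
    ‖rootWeylSum h N‖ ≤ (N.divisors.card : ℝ) := by
  have h1 : ‖rootWeylSum h N‖ ≤ (rho N : ℝ) := Weyl.norm_rootWeylSum_le_rho h N
  have h2 : (rho N : ℝ) ≤ N.divisors.card := by exact_mod_cast rho_le_card_divisors N
  exact h1.trans h2

/-- `τ(mn) ≤ τ(m)·τ(n)` (every divisor of `mn` is a product of a divisor of `m` and one of `n`).
[folklore] -/
theorem card_divisors_mul_le (m n : ℕ) :
    (m * n).divisors.card ≤ m.divisors.card * n.divisors.card := by
  rcases Nat.eq_zero_or_pos m with rfl | hm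
  · simp
  rcases Nat.eq_zero_or_pos n with rfl | hn
  · simp
  calc (m * n).divisors.card
      ≤ ((m.divisors ×ˢ n.divisors).image fun p : ℕ × ℕ => p.1 * p.2).card := by
        refine Finset.card_le_card fun d hd => ?_
        rw [Nat.mem_divisors] at hd
        obtain ⟨y, z, hy, hz, hyz⟩ := Nat.dvd_mul.mp hd.1
        exact Finset.mem_image.mpr ⟨(y, z), Finset.mem_product.mpr
          ⟨Nat.mem_divisors.mpr ⟨hy, hm.ne'⟩, Nat.mem_divisors.mpr ⟨hz, hn.ne'⟩⟩, hyz⟩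
    _ ≤ (m.divisors ×ˢ n.divisors).card := Finset.card_image_le
    _ = m.divisors.card * n.divisors.card := Finset.card_product _ _

/-- **Trivial bound for the kernel**: `‖(n|q)·S(h, nq)‖ ≤ τ(n)·τ(q)`. [folklore] -/
theorem norm_kernel_le (h : ℤ) (n q : ℕ) :
    ‖(jacobiSym (n : ℤ) q : ℂ) * rootWeylSum h (n * q)‖ ≤
      (n.divisors.card : ℝ) * (q.divisors.card : ℝ) := by
  rw [norm_mul]
  have hτ : ((n * q).divisors.card : ℝ) ≤ (n.divisors.card : ℝ) * q.divisors.card := by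
    exact_mod_cast card_divisors_mul_le n q
  calc ‖(jacobiSym (n : ℤ) q : ℂ)‖ * ‖rootWeylSum h (n * q)‖
      ≤ 1 * ((n * q).divisors.card : ℝ) :=
        mul_le_mul (Weyl.norm_jacobiSym_cast_le_one _ _) (norm_rootWeylSum_le_card_divisors h _)
          (norm_nonneg _) zero_le_one
    _ ≤ _ := by rw [one_mul]; exact hτ

/-- The same bound with a unit coefficient: `‖β·(n|q)·S(h,nq)‖ ≤ τ(n)τ(q)` for `‖β‖ ≤ 1`.
[folklore] -/
theorem norm_coeff_kernel_le (h : ℤ) (n q : ℕ) {β : ℂ} (hβ : ‖β‖ ≤ 1) :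
    ‖β * (jacobiSym (n : ℤ) q : ℂ) * rootWeylSum h (n * q)‖ ≤
      (n.divisors.card : ℝ) * (q.divisors.card : ℝ) := by
  rw [mul_assoc, norm_mul]
  calc ‖β‖ * ‖(jacobiSym (n : ℤ) q : ℂ) * rootWeylSum h (n * q)‖
      ≤ 1 * ((n.divisors.card : ℝ) * q.divisors.card) :=
        mul_le_mul hβ (norm_kernel_le h n q) (norm_nonneg _) zero_le_one
    _ = _ := one_mul _

/-- **The divisor bound** in the form used here: for `ε > 0` there is `C ≥ 1` with `τ(n) ≤ C·n^ε`
for all `n` (tree: Hardy–Wright Thm 315, `exists_card_divisors_le_mul_rpow'`). [folklore] -/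
theorem exists_divisorBound {ε : ℝ} (hε : 0 < ε) :
    ∃ C : ℝ, 1 ≤ C ∧ ∀ n : ℕ, (n.divisors.card : ℝ) ≤ C * (n : ℝ) ^ ε :=
  Literature.NumberTheory.Sieve.exists_card_divisors_le_mul_rpow' hε

/-- Monotone form of the divisor bound: `τ(n) ≤ C·N^ε` for `n ≤ N`. [folklore] -/
theorem card_divisors_le_of_le {ε C : ℝ} (hε : 0 < ε)
    (hC : ∀ n : ℕ, (n.divisors.card : ℝ) ≤ C * (n : ℝ) ^ ε) (hC0 : 0 ≤ C) {n N : ℕ} (hn : n ≤ N) :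
    (n.divisors.card : ℝ) ≤ C * (N : ℝ) ^ ε :=
  (hC n).trans (mul_le_mul_of_nonneg_left
    (Real.rpow_le_rpow (Nat.cast_nonneg _) (Nat.cast_le.mpr hn) hε.le) hC0)

end Summit.Parity.BatemanHorn.Cruxes.SplitBlockJacobiCorner.Sketch.MbbOfBoxInputs

namespace Summit.Parity.BatemanHorn.Cruxes.SplitBlockJacobiCorner.Sketch

open Summit.Parity.BatemanHorn.Cruxes.SplitBlockJacobi.CofactorRootDiscrepancy

/-- **Registered stub form** (the congruence-filter move on the support of `S(h,·)`): restated in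
`∀`-form in the crux-line namespace under the name registered on stmt-Parity-15002. [folklore] -/
theorem mbbSupport_filter_move :
    ∀ (a b N : ℕ) (h : ℤ), rootWeylSum h N ≠ 0 → a * b ∣ N → ((a * b) % 4 = 1 ↔ a % 4 = 1 ∧ b % 4 = 1) :=
  fun _ _ _ _ hS hab => MbbOfBoxInputs.mul_mod_four_eq_one_iff_of_rootWeylSum_ne_zero hS hab

end Summit.Parity.BatemanHorn.Cruxes.SplitBlockJacobiCorner.Sketch

end
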